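import Summits.ResolutionOfSingularities.ResolutionOfSingularities.Theses.CleanCovers
import Summits.ResolutionOfSingularities.ResolutionOfSingularities.Theorems.UniversalCellsLocalToGlobalTwoModelPatchingAtOfResolvableDimLe
import Literature.AlgebraicGeometry.Motives.AbelianVarietyIsogenyProofs
import Literature.AlgebraicGeometry.Motives.VarietiesDimensionProofs
import Literature.AlgebraicGeometry.Motives.VarietiesProjectiveSpaceProofs
import Literature.AlgebraicGeometry.Motives.VarietiesProperProofs
import Literature.AlgebraicGeometry.Resolution.PrincipalizationToResolution
import HarnessLib

/-!
# Crux `CleanCovers.CoverResolution` (stmt-ResolutionOfSingularities-15104), line `strategy-split`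
# v2: CERTIFICATES — the crux, L and T hold in dimension / transcendence degree `≤ 3`
# modulo `CossartPiltant2019`

Route `ResolutionOfSingularities/CleanCovers`. The v2 skeleton of the line splits the crux
`CoverResolution` (resolution of Kedlaya covers `f : X → ℙⁿ_k`, `X` integral, `f` finite
surjective and étale over the chart `D₊(xₙ)`, `k` perfect of characteristic `p`) as
**L** (local resolution along the hyperplane at infinity) ∧ **T** (Zariski two-model patching of
proper models over perfect fields). This file records the KNOWN RANGE of all three, modulo the
named fact `CossartPiltant2019` (resolution of reduced separated finite-type schemes of dimension
`≤ 3` over a field, Cossart–Piltant 2019 Thm. 1.1), taken as an explicit hypothesis: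

* `topologicalKrullDim_eq_of_kedlayaCover`: a finite surjective `f : X → ℙⁿ_k` from an integral
  scheme forces `dim X = n` (finite surjective morphisms preserve dimension, Stacks 0ECG; and
  `dim ℙⁿ_k = n`, `ℙⁿ_k → Spec k` being smooth of relative dimension `n`).
* `coverResolution_dim_le_three_of_cossartPiltant2019`: `CoverResolution` for `n ≤ 3` — `X` is
  integral (hence reduced), separated and of finite type over `k` through `f ≫ (ℙⁿ_k → Spec k)`,
  of dimension `n ≤ 3`.
* `boundaryLocalResolution_dim_le_three_of_cossartPiltant2019`: L for `n ≤ 3` — take `B = ⊤` and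
  restrict the resolution of `X` to `f⁻¹(⊤)` (`Scheme.HasResolution.restrict`).
* `twoModelPatchingPerfect_trdeg_le_three_of_cossartPiltant2019`: T for `trdeg_k K ≤ 3` —
  `stub_twoModelPatchingAt_of_resolvable_dimLe` (resolve the join of the two proper models, a proper
  model of dimension `trdeg_k K ≤ 3`) fed with `CossartPiltant2019` on integral `k`-varieties of
  dimension `≤ 3`.

So the open content of the crux and of both pieces of the split starts at `n = 4` / `trdeg = 4`.

## References

* V. Cossart, O. Piltant, *Resolution of singularities of arithmetical threefolds*, J. Algebra 529
  (2019) 268–535, Thm. 1.1. [CossartPiltant2019]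
* The Stacks project, Tag 0ECG (finite surjective morphisms preserve dimension). [StacksProject]
-/

-- single-problem summit: the doubled namespace component `ResolutionOfSingularities` is forced
set_option linter.dupNamespace false

noncomputable section

namespace Summit.ResolutionOfSingularities.ResolutionOfSingularities.Theorems

open CategoryTheory AlgebraicGeometry TopologicalSpace
open Literature.AlgebraicGeometry.Resolution

universe u

/-! ## Dimension of a Kedlaya cover -/

/-- **A finite surjective cover of `ℙⁿ_k` by an integral scheme has dimension `n`.** If `X` is
integral and `f : X → ℙⁿ_k` is finite with surjective underlying map, then
`topologicalKrullDim X = n`: finite surjective morphisms preserve dimension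
(`Scheme.topologicalKrullDim_eq_of_isFinite_of_surjective`, Stacks 0ECG), and the non-empty scheme
`ℙⁿ_k`, smooth of relative dimension `n` over `k`, has dimension `n`
(`topologicalKrullDim_eq_of_smoothOfRelativeDimension`). [cite: StacksProject, Tag 0ECG (Lemma 29.45.9)] -/
theorem topologicalKrullDim_eq_of_kedlayaCover (k : Type u) [Field k] (n : ℕ) (X : Scheme.{u})
    (f : X ⟶ (Literature.AlgebraicGeometry.Motives.projectiveSpace n k).left) [IsIntegral X]
    [IsFinite f] (hsurj : Function.Surjective f.base) : topologicalKrullDim X = n := by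
  haveI : Surjective f := ⟨hsurj⟩
  haveI : SmoothOfRelativeDimension n (Literature.AlgebraicGeometry.Motives.projectiveSpace n k).hom :=
    (Literature.AlgebraicGeometry.Motives.isSmoothProjective_projectiveSpace_holds k n)
      |>.smoothOfRelativeDimension
  haveI : Nonempty ↥(Literature.AlgebraicGeometry.Motives.projectiveSpace n k).left :=
    ⟨f.base (Classical.arbitrary X)⟩
  rw [Literature.AlgebraicGeometry.Motives.Scheme.topologicalKrullDim_eq_of_isFinite_of_surjective f]
  exact Literature.AlgebraicGeometry.Motives.topologicalKrullDim_eq_of_smoothOfRelativeDimension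
    (Literature.AlgebraicGeometry.Motives.projectiveSpace n k).hom n

/-! ## The crux in dimension `≤ 3` -/

/-- **`CoverResolution` holds for `n ≤ 3` modulo `CossartPiltant2019`.** A Kedlaya cover
`f : X → ℙⁿ_k` (`X` integral, `f` finite surjective) is an integral — hence reduced — scheme,
separated and of finite type over `k` through `f ≫ (ℙⁿ_k → Spec k)` (`f` finite, `ℙⁿ_k` proper),
of dimension `n` (`topologicalKrullDim_eq_of_kedlayaCover`); for `n ≤ 3` Cossart–Piltant resolves
it. The étale hypothesis, perfectness and the characteristic are idle.
[cite: CossartPiltant2019, Thm. 1.1] -/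
theorem coverResolution_dim_le_three_of_cossartPiltant2019 : Literature.AlgebraicGeometry.Resolution.CossartPiltant2019.{0} → ∀ p : ℕ, p.Prime → ∀ (k : Type) [Field k] [CharP k p] [PerfectField k] (n : ℕ) (X : AlgebraicGeometry.Scheme.{0}) (f : X ⟶ (Literature.AlgebraicGeometry.Motives.projectiveSpace n k).left), AlgebraicGeometry.IsIntegral X → AlgebraicGeometry.IsFinite f → Function.Surjective f.base → (letI := MvPolynomial.gradedAlgebra (σ := Fin (n + 1)) (R := k); AlgebraicGeometry.Etale (f ∣_ (AlgebraicGeometry.Proj.basicOpen (MvPolynomial.homogeneousSubmodule (Fin (n + 1)) k) (MvPolynomial.X (Fin.last n))))) → n ≤ 3 → Literature.AlgebraicGeometry.Resolution.Scheme.HasResolution X := by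
  intro hCP _ _ k _ _ _ n X f hint hfin hsurj _ hn
  haveI := hfin
  haveI := hint
  haveI : IsProper (Literature.AlgebraicGeometry.Motives.projectiveSpace n k).hom :=
    Literature.AlgebraicGeometry.Motives.isProper_projectiveSpace n k
  -- the `k`-structure of `X`
  let g : X ⟶ Spec (.of k) := f ≫ (Literature.AlgebraicGeometry.Motives.projectiveSpace n k).hom
  haveI : IsSeparated g := inferInstance
  haveI : LocallyOfFiniteType g := inferInstance
  haveI : QuasiCompact g := inferInstance
  have hdim : topologicalKrullDim X ≤ 3 := by
    rw [topologicalKrullDim_eq_of_kedlayaCover k n X f hsurj]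
    exact_mod_cast hn
  exact hCP k X g inferInstance inferInstance inferInstance inferInstance hdim

/-! ## L in dimension `≤ 3` -/

/-- **L (local resolution along the hyperplane at infinity) holds for `n ≤ 3` modulo
`CossartPiltant2019`.** For `n ≤ 3` the whole Kedlaya cover `X` is resolvable
(`coverResolution_dim_le_three_of_cossartPiltant2019`); take `B = ⊤` and restrict the resolution
to the open `f⁻¹(⊤)` (`Scheme.HasResolution.restrict`). [cite: CossartPiltant2019, Thm. 1.1] -/
theorem boundaryLocalResolution_dim_le_three_of_cossartPiltant2019 : Literature.AlgebraicGeometry.Resolution.CossartPiltant2019.{0} → ∀ p : ℕ, p.Prime → ∀ (k : Type) [Field k] [CharP k p] [PerfectField k] (n : ℕ) (X : AlgebraicGeometry.Scheme.{0}) (f : X ⟶ (Literature.AlgebraicGeometry.Motives.projectiveSpace n k).left), AlgebraicGeometry.IsIntegral X → AlgebraicGeometry.IsFinite f → Function.Surjective f.base → (letI := MvPolynomial.gradedAlgebra (σ := Fin (n + 1)) (R := k); AlgebraicGeometry.Etale (f ∣_ (AlgebraicGeometry.Proj.basicOpen (MvPolynomial.homogeneousSubmodule (Fin (n + 1)) k)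 (MvPolynomial.X (Fin.last n))))) → n ≤ 3 → ∀ h : (Literature.AlgebraicGeometry.Motives.projectiveSpace n k).left, (letI := MvPolynomial.gradedAlgebra (σ := Fin (n + 1)) (R := k); h ∉ AlgebraicGeometry.Proj.basicOpen (MvPolynomial.homogeneousSubmodule (Fin (n + 1)) k) (MvPolynomial.X (Fin.last n))) → ∃ B : (Literature.AlgebraicGeometry.Motives.projectiveSpace n k).left.Opens, h ∈ B ∧ Literature.AlgebraicGeometry.Resolution.Scheme.HasResolution ((f ⁻¹ᵁ B : X.Opens) : AlgebraicGeometry.Scheme.{0}) := by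
  intro hCP p hp k _ _ _ n X f hint hfin hsurj het hn _ _
  exact ⟨⊤, trivial, (coverResolution_dim_le_three_of_cossartPiltant2019 hCP p hp k n X f hint hfin
    hsurj het hn).restrict (f ⁻¹ᵁ ⊤)⟩

/-! ## T in transcendence degree `≤ 3` -/

/-- **T (two-model patching of proper models over perfect fields) holds for `trdeg_k K ≤ 3`
modulo `CossartPiltant2019`.** By `stub_twoModelPatchingAt_of_resolvable_dimLe` (resolve the join
`M₁ ⋈ M₂`, a proper model of dimension `trdeg_k K ≤ 3`; a regular proper model dominating the join
is `RegLe` over both) it suffices to resolve integral separated finite-type `k`-schemes of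
dimension `≤ 3`, which Cossart–Piltant does (integral schemes are reduced). Perfectness and the
characteristic are idle. [cite: CossartPiltant2019, Thm. 1.1] -/
theorem twoModelPatchingPerfect_trdeg_le_three_of_cossartPiltant2019 : Literature.AlgebraicGeometry.Resolution.CossartPiltant2019.{0} → ∀ p : ℕ, p.Prime → ∀ (k : Type) [Field k] [CharP k p] [PerfectField k] (K : Type) [Field K] [Algebra k K] [Algebra.EssFiniteType k K], Algebra.trdeg k K ≤ 3 → ∀ (M₁ M₂ : Literature.AlgebraicGeometry.Resolution.ProperModel k K), ∃ (N : Literature.AlgebraicGeometry.Resolution.ProperModel k K) (φ₁ : N.Hom M₁) (φ₂ : N.Hom M₂), φ₁.RegLe ∧ φ₂.RegLe := by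
  intro hCP _ _ k _ _ _ K _ _ _ hK M₁ M₂
  refine stub_twoModelPatchingAt_of_resolvable_dimLe k 3 (fun X f hs hl hq hi hd => ?_) K
    (by exact_mod_cast hK) M₁ M₂
  haveI := hi
  exact hCP k X f hs hl hq inferInstance hd

end Summit.ResolutionOfSingularities.ResolutionOfSingularities.Theorems

end
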